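import Mathlib
import HarnessLib

/-!
# Equivariance on a dense subgroup extends to the whole group

Standard closure arguments for a topological group `G` acting continuously on spaces `X` and `E` (`E`
Hausdorff) and a DENSE subgroup `Δ ≤ G` (typical source of `Δ`: the rational points of an algebraic group,
dense in the real points by real / weak approximation):

* `DenseSubgroup.smul_eq_of_dense` — if `ℓ : X → E` is continuous on an open set `Ω` and `Δ`-equivariant there
  (at pairs `x, γ • x ∈ Ω`), then `ℓ (g • x₀) = g • ℓ x₀` for every `x₀ ∈ Ω` and every `g : G` with
  `g • x₀ ∈ Ω` (two continuous maps `G → E` agreeing on the dense part `U ∩ Δ` of the open set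
  `U = {h | h • x₀ ∈ Ω}` agree on `U`, `Set.EqOn.of_subset_closure`; no sequences, no first countability);
* `DenseSubgroup.stabilizer_smul_eq`, `DenseSubgroup.stabilizer_le_stabilizer` — hence `ℓ x₀` is fixed by the
  whole isotropy group of `x₀`;
* `DenseSubgroup.false_of_isotropy_moves` — so no such `ℓ` exists with `ℓ x₀` in a "fibre" every point of which
  is moved by some element of the isotropy group;
* `DenseSubgroup.dense_orbit_of_dense` — a dense subgroup has dense orbits wherever the orbit map of `G` is onto;
  `DenseSubgroup.inter_nonempty_of_stable` — hence a non-empty `Δ`-stable set meets every non-empty open set.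

All statements are elementary point-set topology. [folklore]

## Provenance

Staged by the pub-hodgecm formalisation cell (DAG-node prover #01 lineage) under the LEAN-IN-TREE rule; it
supersedes the generic part of the cell's standalone package file `HodgeCM/PerL34/LineFieldRigidity.lean`
(namespace `HodgeCM.PerL34.LineField` ↦ `Literature.Topology.Algebra.DenseSubgroup`, same short names), where it
is the topological core of a "line field invariant under a dense subgroup is invariant under the isotropy group"
argument.

## Not here

Any statement producing the dense subgroup (real approximation) or the transitivity of an action; those are
inputs of the lemmas.
-/

set_option autoImplicit false

open Set
open scoped Topology

namespace Literature.Topology.Algebra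

namespace DenseSubgroup

variable {G X E : Type*} [TopologicalSpace G] [Group G]
  [TopologicalSpace X] [MulAction G X] [ContinuousSMul G X]
  [TopologicalSpace E] [MulAction G E] [ContinuousSMul G E] [T2Space E]

/-- **Equivariance extends from a dense subgroup.**  If `ℓ` is continuous on the open set `Ω` and
`Δ`-equivariant there (at pairs `x, γ • x ∈ Ω`), and `Δ` is dense in `G`, then `ℓ (g • x₀) = g • ℓ x₀` for
every `x₀ ∈ Ω` and every `g : G` with `g • x₀ ∈ Ω`. [folklore] -/
theorem smul_eq_of_dense (Δ : Subgroup G) (hΔ : Dense (Δ : Set G))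
    {Ω : Set X} (hΩ : IsOpen Ω) {ℓ : X → E} (hℓ : ContinuousOn ℓ Ω)
    (heqv : ∀ γ : G, γ ∈ Δ → ∀ x ∈ Ω, γ • x ∈ Ω → ℓ (γ • x) = γ • ℓ x)
    {x₀ : X} (hx₀ : x₀ ∈ Ω) {g : G} (hg : g • x₀ ∈ Ω) :
    ℓ (g • x₀) = g • ℓ x₀ := by
  -- `U` = the open set of group elements moving `x₀` into `Ω`; it contains `g`.
  set U : Set G := {h : G | h • x₀ ∈ Ω} with hU
  have hUopen : IsOpen U := hΩ.preimage (by fun_prop)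
  have hcont₁ : ContinuousOn (fun h : G => ℓ (h • x₀)) U :=
    hℓ.comp (by fun_prop : Continuous fun h : G => h • x₀).continuousOn (fun h hh => hh)
  have hcont₂ : ContinuousOn (fun h : G => h • ℓ x₀) U := by fun_prop
  -- the two continuous maps agree on the dense part `U ∩ Δ` of the open set `U`
  have hEqOn : EqOn (fun h : G => ℓ (h • x₀)) (fun h : G => h • ℓ x₀) (U ∩ (Δ : Set G)) := by
    intro h hh
    exact heqv h hh.2 x₀ hx₀ hh.1
  have hsub : U ∩ (Δ : Set G) ⊆ U := inter_subset_left
  have hclos : U ⊆ closure (U ∩ (Δ : Set G)) := hΔ.open_subset_closure_inter hUopen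
  have key := hEqOn.of_subset_closure hcont₁ hcont₂ hsub hclos
  exact key hg

/-- **Isotropy invariance**: under the hypotheses of `smul_eq_of_dense`, every element of the isotropy group
of `x₀ ∈ Ω` fixes `ℓ x₀`. [folklore] -/
theorem stabilizer_smul_eq (Δ : Subgroup G) (hΔ : Dense (Δ : Set G))
    {Ω : Set X} (hΩ : IsOpen Ω) {ℓ : X → E} (hℓ : ContinuousOn ℓ Ω)
    (heqv : ∀ γ : G, γ ∈ Δ → ∀ x ∈ Ω, γ • x ∈ Ω → ℓ (γ • x) = γ • ℓ x)
    {x₀ : X} (hx₀ : x₀ ∈ Ω) {k : G} (hk : k • x₀ = x₀) :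
    k • ℓ x₀ = ℓ x₀ := by
  have hkΩ : k • x₀ ∈ Ω := by rw [hk]; exact hx₀
  have h := smul_eq_of_dense Δ hΔ hΩ hℓ heqv hx₀ hkΩ
  rw [hk] at h
  exact h.symm

/-- The same, phrased with `MulAction.stabilizer`: the stabiliser of `x₀` is contained in the stabiliser of
`ℓ x₀`. [folklore] -/
theorem stabilizer_le_stabilizer (Δ : Subgroup G) (hΔ : Dense (Δ : Set G))
    {Ω : Set X} (hΩ : IsOpen Ω) {ℓ : X → E} (hℓ : ContinuousOn ℓ Ω)
    (heqv : ∀ γ : G, γ ∈ Δ → ∀ x ∈ Ω, γ • x ∈ Ω → ℓ (γ • x) = γ • ℓ x)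
    {x₀ : X} (hx₀ : x₀ ∈ Ω) :
    MulAction.stabilizer G x₀ ≤ MulAction.stabilizer G (ℓ x₀) := by
  intro k hk
  rw [MulAction.mem_stabilizer_iff] at hk ⊢
  exact stabilizer_smul_eq Δ hΔ hΩ hℓ heqv hx₀ hk

/-- **No invariant point in the fibre ⇒ no equivariant field**: if every point `e` of `E` satisfying the
caller's fibre predicate `F` is moved by some element of the isotropy group of `x₀`, then a `Δ`-equivariant
`ℓ`, continuous on an open `Ω ∋ x₀` with `F (ℓ x₀)`, cannot exist. [folklore] -/
theorem false_of_isotropy_moves (Δ : Subgroup G) (hΔ : Dense (Δ : Set G))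
    {Ω : Set X} (hΩ : IsOpen Ω) {ℓ : X → E} (hℓ : ContinuousOn ℓ Ω)
    (heqv : ∀ γ : G, γ ∈ Δ → ∀ x ∈ Ω, γ • x ∈ Ω → ℓ (γ • x) = γ • ℓ x)
    {x₀ : X} (hx₀ : x₀ ∈ Ω) (F : E → Prop) (hF : F (ℓ x₀))
    (hmoves : ∀ e : E, F e → ∃ k : G, k • x₀ = x₀ ∧ k • e ≠ e) : False := by
  obtain ⟨k, hk, hne⟩ := hmoves (ℓ x₀) hF
  exact hne (stabilizer_smul_eq Δ hΔ hΩ hℓ heqv hx₀ hk)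

omit [TopologicalSpace E] [MulAction G E] [ContinuousSMul G E] [T2Space E] in
/-- A dense subgroup `Δ` of `G` has dense orbits wherever `G` acts with surjective orbit map `g ↦ g • x`.
[folklore] -/
theorem dense_orbit_of_dense (Δ : Subgroup G) (hΔ : Dense (Δ : Set G)) (x : X)
    (hsurj : Function.Surjective fun g : G => g • x) :
    Dense ((fun g : G => g • x) '' (Δ : Set G)) :=
  (hsurj.denseRange).dense_image (by fun_prop) hΔ

omit [TopologicalSpace E] [MulAction G E] [ContinuousSMul G E] [T2Space E] in
/-- If `Ω₁` is `Δ`-stable and non-empty, `Ω₂` is open and non-empty, and `Δ`-orbits are dense (surjective orbit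
maps of `G`, `Δ` dense), then `Ω₁ ∩ Ω₂ ≠ ∅`. [folklore] -/
theorem inter_nonempty_of_stable (Δ : Subgroup G) (hΔ : Dense (Δ : Set G))
    (hsurj : ∀ x : X, Function.Surjective fun g : G => g • x)
    {Ω₁ Ω₂ : Set X} (h₁ : Ω₁.Nonempty) (hstab : ∀ γ : G, γ ∈ Δ → ∀ x ∈ Ω₁, γ • x ∈ Ω₁)
    (h₂ : IsOpen Ω₂) (h₂ne : Ω₂.Nonempty) : (Ω₁ ∩ Ω₂).Nonempty := by
  obtain ⟨x, hx⟩ := h₁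
  have hd := dense_orbit_of_dense (X := X) Δ hΔ x (hsurj x)
  obtain ⟨y, hyΩ₂, ⟨γ, hγ, rfl⟩⟩ := hd.inter_open_nonempty Ω₂ h₂ h₂ne
  exact ⟨γ • x, hstab γ hγ x hx, hyΩ₂⟩

end DenseSubgroup

end Literature.Topology.Algebra
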